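import Summits.Langlands.Langlands.Theorems.IrreducibilityBySelfDualityReciprocityUpToIrreducibilityCorrespondsConj

/-!
# Stub `stub_primeAscent` (line `registered`, crux `BaseFieldAscent.AscentConjugationSolvable`,
stmt-Langlands-1094) — feasibility census and the closed seams of the prime ascent

Support file (closes nothing; `--supports stmt-Langlands-1094`).  The registered stub (VERBATIM the body
of item stmt-Langlands-18649 `SmithKummerSeed.CyclicPrimeAscent`) reads: for `L/K` Galois of PRIME degree,
`Recip K → Recip L`, where `Recip X := ∃ R : ReciprocityData X, ∀ n > 0, ∀ hcpt,
GlobalLanglandsCorrespondenceGLn n X R hcpt`.  It is NOT proved here (worker verdict `stub-blocked`,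
2026-08-17); this file records WHY, with the absences checked against the tree, and lands the two
bookkeeping seams of the up-step that ARE theorems today, so that a future proof only has to supply
the three honest inputs (I1)–(I3) below.

## What a proof must supply, and what the tree has (checked with `lean search`, 2026-08-17)

* **(I1) a term `R : ReciprocityData L`** — the conclusion is `∃ R, …`, and NO file of the tree inhabits
  `ReciprocityData X` for any number field `X` (`ReciprocityTRCM.nonempty_reciprocityData_iff`, module
  `BaseFieldAscentReciprocityTRCMAutToGalSeams`: it is, place by place, a `LocalLanglandsDatum (L_w)` whose
  Artin map and whose `ε`-system's Artin maps are THE canonical ones).  In the tree this is exactly the conjunction of two UNPROVED named facts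
  (`def … : Prop`, no `_holds` anywhere): `Literature.NumberTheory.Automorphic.localLanglands_gl`
  (Harris–Taylor 2001 Thm. A / Henniart 2000, at every completion `w.adicCompletion L`) and
  `Literature.NumberTheory.Automorphic.nonempty_localEpsilonSystem_isCanonical` (Deligne 1973 Thm. 4.1
  with the class-field normalisation retained) — reduction landed as
  `ReciprocityUpToIrreducibilityR.stub_nonempty_of_inputs`; the weaker named fact
  `LocalLanglandsDatum.nonempty` does not even suffice (no canonicity pins).  The hypothesis `Recip K`
  does not help: at a place `w` of `L` inert or ramified over `v` (such places exist, `[L:K]` prime),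
  `L_w` is a proper extension of `K_v` and is not a completion of `K`, and the tree has no transport of
  `LocalLanglandsDatum` along local base change.  THIS IS THE FIRST INDISPENSABLE MISSING PIECE: without
  it not even the `∃ R` of the conclusion can be introduced, whatever the automorphic input.
* **(I2) direction (A) over `L` for that `R`** ((A)-existence suffices: `recip_iff_forall_exists_and_weak`).
  Printed route: `AI_{L/K}(π′ ⊗ χ)`, (A) over `K`, restriction to `Γ_L`, Clifford + de-induction over
  twists, local–global compatibility transported from `K`.  Tree status: automorphic induction is the
  UNPROVED named facts `automorphicInduction_cyclic` / `automorphicInduction_cyclic_cuspidal`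
  (Arthur–Clozel Ch. 3 Thm. 6.2; a.e. Satake relations only) and, for Galois-stable `π′`,
  `ArthurClozel1989_cuspidal_descent` (unproved); L-algebraicity of lifts only under
  `ArthurClozel1989_strongLifting_archimedean` / `Henniart2012_infinityType_of_automorphicInduction`
  (unproved); de-induction over twists exists for `p = 2` a.e. only (`QuadraticWindow.TwistUnpackaging`).
  ABSENT NOTIONS (0 hits): local base change / local automorphic induction of RAMIFIED smooth irreducibles
  of `GL_n(K_v)` compatible with `LocalLanglandsDatum.recGL` (searched `Shintani`, `localBaseChange`,
  `IsLocalLift`, `IsLocalBaseChange`) — so `LocalGlobalCompatibleAt R` at a ramified `w` of `L` cannot be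
  derived from `K`; and invariance of `PstWeilDeligneData.IsDeRhamFramed` for Fontaine's pinned datum
  `fontainePstAdicCompletion` under restriction `Γ_{K_v} ↝ Γ_{L_w}` (searched `isDeRhamFramed.*restrict`:
  only `isDeRham_restrictScalarsQl`, a change of coefficients) — so `IsGeometricFramed R (ρ.restrictField)`
  at `w ∣ ℓ` cannot be derived either.  The Galois-side restriction API away from `ℓ` IS present
  (`FramedGaloisRep.isUnramifiedAt_restrictField`, `hasFrobCharpolyAt_restrictField`,
  `hasFrobCharpolyAt_restrictField_arithFrobPolyOfSatake`, `hasFrobCharpolyAt_outerConj_iff`).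
* **(I3) weak direction (B) over `L` for that `R`** (a.e. Satake matching suffices:
  `recip_iff_forall_exists_and_weak`, through the landed Chebotarev–Brauer–Nesbitt transport
  `ReciprocityUpToIrreducibility.corresponds_of_exists_corresponds`).  Printed route: `Ind_L^K ρ′`, (B)
  over `K`, cyclic base change, identification by (A) over `L`.  Tree status: NO induction `Ind_L^K` of
  `FramedGaloisRep` (0 hits for `induced`/`induction` on `FramedGaloisRep`/`GaloisRep`; only the Artin-side
  `Prop` `ArtinRep.IsInducedFrom`); cyclic base change is the UNPROVED named fact `exists_baseChange_cyclic`
  (a.e., output a bare `AutomorphicRepData`, no isobaric decomposition), fibres/image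
  `ArthurClozel1989_fibres_of_baseChange` unproved.

Hence the stub is conditional on at least `localLanglands_gl` ∧ `nonempty_localEpsilonSystem_isCanonical`
(I1) before any automorphic argument starts, and on the Arthur–Clozel named facts plus two notions absent
from the tree after that.  Nothing weaker than the registered signature is landed.

## What IS landed here (closed, hypothesis-free, `Summit.Langlands` objects only)

* `isCyclic_algEquiv_of_finrank_prime` — a Galois layer of prime degree has CYCLIC group: converts the
  stub's hypothesis `(Module.finrank K L).Prime` into the hypothesis `IsCyclic (L ≃ₐ[K] L)` of every
  Arthur–Clozel fact of the tree (`exists_baseChange_cyclic`, `automorphicInduction_cyclic_cuspidal`, …).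
* `recip_of_forall_exists_of_weak` — for ONE number field `F` and ONE datum `R`: (A)-existence in every
  rank (irreducible, pinned-geometric, corresponding `ρ` for every L-algebraic cuspidal `π`, no uniqueness
  clause) and WEAK (B) in every rank (a.e. Satake matching of every irreducible geometric `ρ` by some
  L-algebraic cuspidal `π`) already give `GlobalLanglandsCorrespondenceGLn n F R hcpt` for all `n ≥ 1`:
  uniqueness up to conjugacy and local–global compatibility in (B) are theorems of the tree
  (`ReciprocityUpToIrreducibility.isConjugate_of_satakeFrobCompatibleAt`,
  `ReciprocityUpToIrreducibility.corresponds_of_exists_corresponds`; cf.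
  `ReciprocityTRCM.automorphicToGalois_of_forall_exists`).
* `recip_iff_forall_exists_and_weak` (helper stub registered on stmt-Langlands-1094 by the worker for this
  landing, closed form) — `Recip F` is EQUIVALENT to `∃ R, (A)-existence ∧ weak (B)`: the honest target of
  the up-step (and of the down-step `stub_primeDescent`), i.e. exactly (I1) ∧ (I2) ∧ (I3).
* `forall_exists_localLanglandsDatum_of_recip` — `Recip F` forces, at EVERY finite place `w` of `F`, a
  local Langlands datum for `GL_n(F_w)` with canonical Artin pins: the formal content of blocker (I1).

References: [ArthurClozelAMS120] Ch. 3 Thms 4.2, 5.1, 6.2; [HarrisTaylorAMS2001] Thm. A;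
[Deligne1973Constantes] Thm. 4.1; [DeligneSerreASENS1974] Lemme 3.2; [BuzzardGeeLMS2014] Conj. 3.2.1–3.2.2.
-/

set_option linter.dupNamespace false -- mandated Summit.Langlands.Langlands namespace (D-0017); the linter fires on every decl otherwise

noncomputable section

open scoped MatrixGroups NumberField
open NumberField IsDedekindDomain Filter
open Literature.NumberTheory.Automorphic Literature.NumberTheory.GaloisRepresentations
open Summit.Langlands

namespace Summit.Langlands.Langlands.Theorems.BaseFieldAscentAscentConjugationSolvable

/-! ## 1. Prime degree ⇒ cyclic group -/

/-- **A Galois layer of prime degree is cyclic.**  For a Galois extension of number fields `L/K` with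
`[L:K]` prime, `Gal(L/K)` has prime order (`IsGalois.card_aut_eq_finrank`), hence is cyclic
(`isCyclic_of_prime_card`).  Feeds the `IsCyclic (L ≃ₐ[K] L)` hypothesis of the tree's Arthur–Clozel
facts from the stub's `(Module.finrank K L).Prime`. [folklore] -/
theorem isCyclic_algEquiv_of_finrank_prime (K L : Type) [Field K] [NumberField K] [Field L]
    [NumberField L] [Algebra K L] [IsGalois K L] (hp : (Module.finrank K L).Prime) :
    IsCyclic (L ≃ₐ[K] L) :=
  haveI : FiniteDimensional K L := Module.Finite.of_restrictScalars_finite ℚ K L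
  haveI : Fact (Module.finrank K L).Prime := ⟨hp⟩
  isCyclic_of_prime_card (α := L ≃ₐ[K] L) (p := Module.finrank K L)
    (IsGalois.card_aut_eq_finrank K L)

/-! ## 2. The honest target of the up-step: data, (A)-existence, weak (B) -/

section OneField

variable (F : Type) [Field F] [NumberField F]

/-- **Reciprocity for `R` from (A)-existence and weak (B), every rank.**  If every L-algebraic cuspidal
`π` of `GL_n(𝔸_F)` has, for all `ℓ, ι`, SOME irreducible pinned-geometric `ρ` corresponding to it at
every finite place, and every irreducible geometric `ρ` is Satake–Frobenius compatible almost everywhere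
with SOME L-algebraic cuspidal `π`, then `GlobalLanglandsCorrespondenceGLn n F R hcpt` holds for every
`n ≥ 1`: the uniqueness clause of (A) is Chebotarev + Brauer–Nesbitt (two avatars of one `π`, one of
them irreducible, are conjugate: `ReciprocityUpToIrreducibility.isConjugate_of_satakeFrobCompatibleAt`,
which only reads the Satake half of `Corresponds`), and local–global compatibility in (B) is transported
from the (A)-avatar of `π` along the conjugacy it forces
(`ReciprocityUpToIrreducibility.corresponds_of_exists_corresponds`).
[cite: DeligneSerreASENS1974, Lemme 3.2] [cite: BuzzardGeeLMS2014, Conj. 3.2.1–3.2.2] -/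
theorem recip_of_forall_exists_of_weak (R : ReciprocityData F)
    (hA : ∀ n : ℕ, 0 < n → ∀ (hcpt : isCompact_glFiniteIntegralLevel n F)
      (π : CuspidalAutomorphicRepData n F hcpt), π.1.IsLAlgebraic →
        ∀ (ℓ : ℕ) [Fact ℓ.Prime] (ι : PadicAlgCl ℓ ≃+* ℂ),
          ∃ ρ : FramedGaloisRep F (PadicAlgCl ℓ) n,
            ρ.toGaloisRep.IsIrreducible ∧ IsGeometricFramed R ρ ∧ Corresponds R ι π.1 ρ)
    (hW : ∀ n : ℕ, 0 < n → ∀ (ℓ : ℕ) [Fact ℓ.Prime] (ι : PadicAlgCl ℓ ≃+* ℂ)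
      (ρ : FramedGaloisRep F (PadicAlgCl ℓ) n), ρ.toGaloisRep.IsIrreducible → IsGeometricFramed R ρ →
        ∀ hcpt : isCompact_glFiniteIntegralLevel n F, ∃ π : CuspidalAutomorphicRepData n F hcpt,
          π.1.IsLAlgebraic ∧
            ∀ᶠ v : HeightOneSpectrum (𝓞 F) in cofinite, SatakeFrobCompatibleAt ι π.1 ρ v) :
    ∀ n : ℕ, 0 < n → ∀ hcpt : isCompact_glFiniteIntegralLevel n F,
      GlobalLanglandsCorrespondenceGLn n F R hcpt := by
  intro n hn hcpt
  refine ⟨fun π hL ℓ _ ι => ?_, fun ℓ _ ι ρ hirr hgeo => ?_⟩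
  · obtain ⟨ρ, hirr, hgeo, hcorr⟩ := hA n hn hcpt π hL ℓ ι
    exact ⟨ρ, hirr, hgeo, hcorr, fun ρ' h' =>
      ReciprocityUpToIrreducibility.isConjugate_of_satakeFrobCompatibleAt π.1 ι hirr hcorr.1 h'.1⟩
  obtain ⟨π, hL, hsat⟩ := hW n hn ℓ ι ρ hirr hgeo hcpt
  obtain ⟨ρ', -, -, hcorr'⟩ := hA n hn hcpt π hL ℓ ι
  exact ⟨π, hL,
    ReciprocityUpToIrreducibility.corresponds_of_exists_corresponds hirr hsat ⟨ρ', hcorr'⟩⟩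

/-- **`Recip F` ⇔ data + (A)-existence + weak (B)** (registered helper stub of line `registered`,
closed form).  Reciprocity for `GL_n` over `F` in the shape of the crux (`∃ R, ∀ n > 0, ∀ hcpt, (A) ∧ (B)`)
is equivalent to the existence of reciprocity data `R` carrying (A)-existence in every rank and weak (B)
(a.e. Satake matching) in every rank.  `→`: drop the uniqueness clause of (A) and the local–global half of
`Corresponds` in (B); `←`: `recip_of_forall_exists_of_weak`.  This is the honest target of
`stub_primeAscent` at `F := L` (and of `stub_primeDescent` at `F := K`).
[cite: DeligneSerreASENS1974, Lemme 3.2] [cite: BuzzardGeeLMS2014, Conj. 3.2.1–3.2.2] -/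
theorem recip_iff_forall_exists_and_weak : ∀ (F : Type) [Field F] [NumberField F], (∃ R : ReciprocityData F, ∀ n : ℕ, 0 < n → ∀ hcpt : Literature.NumberTheory.Automorphic.isCompact_glFiniteIntegralLevel n F, GlobalLanglandsCorrespondenceGLn n F R hcpt) ↔ ∃ R : ReciprocityData F, (∀ n : ℕ, 0 < n → ∀ (hcpt : Literature.NumberTheory.Automorphic.isCompact_glFiniteIntegralLevel n F) (π : Literature.NumberTheory.Automorphic.CuspidalAutomorphicRepData n F hcpt), π.1.IsLAlgebraic → ∀ (ℓ : ℕ) [Fact ℓ.Prime] (ι : PadicAlgCl ℓ ≃+* ℂ), ∃ ρ : Literature.NumberTheory.GaloisRepresentations.FramedGaloisRep F (PadicAlgCl ℓ) n, ρ.toGaloisRep.IsIrreducible ∧ IsGeometricFramed R ρ ∧ Corresponds R ι π.1 ρ) ∧ (∀ n : ℕ, 0 < n → ∀ (ℓ : ℕ) [Fact ℓ.Prime] (ι : PadicAlgCl ℓ ≃+* ℂ) (ρ : Literature.NumberTheory.GaloisRepresentations.FramedGaloisRep F (PadicAlgCl ℓ) n), ρ.toGaloisRep.IsIrreducible → IsGeometricFramed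 R ρ → ∀ hcpt : Literature.NumberTheory.Automorphic.isCompact_glFiniteIntegralLevel n F, ∃ π : Literature.NumberTheory.Automorphic.CuspidalAutomorphicRepData n F hcpt, π.1.IsLAlgebraic ∧ ∀ᶠ v : IsDedekindDomain.HeightOneSpectrum (NumberField.RingOfIntegers F) in cofinite, SatakeFrobCompatibleAt ι π.1 ρ v) := by
  intro F _ _
  constructor
  · rintro ⟨R, hR⟩
    refine ⟨R, fun n hn hcpt π hL ℓ _ ι => ?_, fun n hn ℓ _ ι ρ hirr hgeo hcpt => ?_⟩
    · obtain ⟨ρ, hirr, hgeo, hcorr, -⟩ := (hR n hn hcpt).1 π hL ℓ ι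
      exact ⟨ρ, hirr, hgeo, hcorr⟩
    · obtain ⟨π, hL, hcorr⟩ := (hR n hn hcpt).2 ℓ ι ρ hirr hgeo
      exact ⟨π, hL, hcorr.1⟩
  · rintro ⟨R, hA, hW⟩
    exact ⟨R, recip_of_forall_exists_of_weak F R hA hW⟩

/-- **Blocker (I1), formally: `Recip F` forces canonically normalised local Langlands data at every
finite place of `F`** — a `LocalLanglandsDatum (F_w)` (Harris–Taylor's `rec` with its six-clause
characterisation) whose local Artin map, and whose `ε`-system's Artin maps at every finite `E/F_w`, are
THE canonical ones.  In the tree these are the unproved named facts `localLanglands_gl` and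
`nonempty_localEpsilonSystem_isCanonical` at `w.adicCompletion F`; so the conclusion of
`stub_primeAscent` cannot be reached before they (or a construction) land, whatever the automorphic input.
[cite: HarrisTaylorAMS2001, Thm. A] -/
theorem forall_exists_localLanglandsDatum_of_recip
    (h : ∃ R : ReciprocityData F, ∀ n : ℕ, 0 < n → ∀ hcpt : isCompact_glFiniteIntegralLevel n F,
      GlobalLanglandsCorrespondenceGLn n F R hcpt) :
    ∀ w : HeightOneSpectrum (𝓞 F), ∃ LLD : LocalLanglandsDatum (w.adicCompletion F),
      LLD.artin.IsCanonical ∧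
        ∀ (E : Type) [Field E] [ValuativeRel E] [TopologicalSpace E] [IsNonarchimedeanLocalField E]
          [Algebra (w.adicCompletion F) E] [FiniteDimensional (w.adicCompletion F) E],
          (LLD.eps.artin E).IsCanonical := by
  obtain ⟨R, -⟩ := h
  exact fun w => ⟨R.llc w, R.llc_isCanonical w, fun E _ _ _ _ _ _ => R.llc_eps_isCanonical w E⟩

end OneField

end Summit.Langlands.Langlands.Theorems.BaseFieldAscentAscentConjugationSolvable

end
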